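import Literature.Probability.RandomPlanarGeometry.SLERSObservableIto
import Literature.Probability.Process.StoppedMartingale
import HarnessLib

/-!
# Exponential functionals of the SLE slope diffusion: the Itô decomposition, optional stopping

Topic `Probability/RandomPlanarGeometry`; theorems and three small definitions. This is the
stochastic-calculus tool of the **sharp one-point upper estimate** for the SLE_κ trace
(V. Beffara, *The dimension of the SLE curves*, Ann. Probab. 36 (2008), Prop. 4, upper half;
file `SLEOnePointUpperEstimate.lean`), written once for a general test function.

Setting (Rohde–Schramm (2005), proof of Lemma 6.3, p. 904): `z ∈ ℍ`, `zₜ = gₜ(z) - √κ Bₜ = xₜ + i yₜ`,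
the slope `wₜ = xₜ/yₜ = cot arg zₜ`, stopped at a stopping time `σ ≤ ρₙ` (`slePointLocTime`) of the
raw Brownian filtration along which `|w| ≤ S`. In the clock `du = dt/y²` the slope is the
autonomous diffusion `dw = (4w/(1+w²)) du - √κ dB̃ᵤ` with generator

  `A F = (κ/2) F'' + (4w/(1+w²)) F'`     (`slopeGen`).

**Main theorem** (`exists_martingale_slopeFunctional`). For `F ∈ C²(ℝ)` and a bounded,
continuous, strongly adapted process `E` solving pathwise `Eₜ = 1 + ∫₀ᵗ βₛ Eₛ ds` with `β` bounded
progressive (e.g. `Eₜ = exp ∫₀ᵗ βₛ ds`), there is a martingale `K` with a.s. continuous paths,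
`K₀ = 0`, such that almost surely, for all `t`,

  `F(w_{t∧σ}) Eₜ = F(w₀) + ∫₀ᵗ ( 𝟙_{s ≤ σ} Eₛ yₛ⁻² (A F)(wₛ) + F(wₛ) βₛ Eₛ ) ds + Kₜ`.

This is Itô's formula for `F(w)` (the tree's `ito_formula_itoProcess_ae_holds`, with
`dw = 4w/|z|² dt - (√κ/y) dB` from the product rule `w = x · (1/y)`, exactly as in
`SLERSObservableIto.lean`) followed by the product rule with the finite-variation factor `E`
(`ae_mul_eq_of_isItoProcess`); the drift of `F(w)` is `y⁻² (A F)(w)` (`slope_itoDrift_eq`).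
Instances: `β = 𝟙_{s≤σ} a·4y²/|z|⁴` and `F = Ĝ_{a,κ}` give Rohde–Schramm's martingale `ψ^a Ĝ(w)`
(drift `0` by (6.9)); `β = 0`, `F = (1+w²)^{-(4/κ-1/2)}` give a supermartingale; `β = μ 𝟙 g(w)/y²`,
`F = 1 + μ U` with `A U = -2g` give the exponential supermartingales bounding occupation
functionals of the slope (all in `SLEOnePointUpperEstimate.lean`).

**Optional stopping tools** (general filtration-free lemmas on the canonical space):
`integral_stoppedValue_eq_zero_of_martingale` — `E[K_T] = 0` for a martingale `K` with a.s.
continuous paths, `K₀ = 0`, and a bounded stopping time `T` (the stopped process is an a.e.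
martingale, `Martingale.isAEMartingale_stoppedProcess`, Le Gall (2016), Cor. 3.24);
`isStoppingTime_piecewise_of_le` — for stopping times `T₁ ≤ T₂` and `G ∈ 𝓕_{T₁}` the time
`T_G = T₁` on `G`, `T₂` off `G` is a stopping time; hence `setIntegral_stoppedValue_sub_eq_zero`:
`∫_G (K_{T₂} - K_{T₁}) dP = 0`, the form in which conditional (strong-Markov-free) estimates
"from time `T₁` on, on the event `G`" are obtained in the sequel.

## References

* V. Beffara, *The dimension of the SLE curves*, Ann. Probab. 36 (2008), Prop. 4 (eqs. (2.6)–(2.8):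
  the diffusion `θₛ = 2 arg z` and its generator).
* S. Rohde, O. Schramm, *Basic properties of SLE*, Ann. of Math. 161 (2005), proof of Lemma 6.3
  (pp. 904–906), eq. (6.9).
* D. Revuz, M. Yor, *Continuous Martingales and Brownian Motion* (1999), Ch. IV, Prop. (3.1),
  Thm (3.3); Ch. II, Thm (3.2) (optional stopping).
* J.-F. Le Gall, *Brownian Motion, Martingales, and Stochastic Calculus* (2016), Thm 3.22, Cor. 3.24.
-/

noncomputable section

open Set Filter MeasureTheory Complex
open _root_.Topology
open scoped NNReal ENNReal

namespace Literature.Probability.RandomPlanarGeometry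

open Loewner Literature.Probability.Process Literature.Analysis.FunctionSpaces

/-! ### The generator of the slope diffusion and the Itô drift of `F(w)` -/

section Generator

/-- **The generator of the slope diffusion** `wₜ = xₜ/yₜ` of the centred SLE_κ flow in the clock
`du = dt/yₜ²`: `(A F)(w) = (κ/2) F''(w) + (4w/(1+w²)) F'(w)` (Rohde–Schramm (2005), p. 904:
"`w(u)` is a time-homogeneous diffusion"; eq. (6.9) is `A Ĝ + (4a/(1+w²)²) Ĝ = 0`).
[cite: RohdeSchramm2005, Lemma 6.3 (proof)] -/
def slopeGen (κ : ℝ≥0) (F : ℝ → ℝ) (w : ℝ) : ℝ :=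
  (κ : ℝ) / 2 * iteratedDeriv 2 F w + 4 * w / (1 + w ^ 2) * deriv F w

/-- Unfolding lemma for `slopeGen`. [folklore] -/
theorem slopeGen_apply (κ : ℝ≥0) (F : ℝ → ℝ) (w : ℝ) :
    slopeGen κ F w = (κ : ℝ) / 2 * iteratedDeriv 2 F w + 4 * w / (1 + w ^ 2) * deriv F w := rfl

/-- **The Itô drift of `F(x/y)` along the centred flow is `y⁻² (A F)(x/y)`**: with
`dx = (2x/|z|²) dt - √κ dB`, `d(1/y) = 2/(y|z|²) dt`, `dw = x d(1/y) + (1/y) dx`, the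
`dt`-coefficient `(x·2/(y|z|²) + (1/y)·2x/|z|²) F'(w) + ½ (√κ/y)² F''(w)` equals
`y⁻² [(κ/2) F'' + (4w/(1+w²)) F'](w)` (`|z|² = y²(1+w²)`). [cite: RohdeSchramm2005, Lemma 6.3 (proof)] -/
theorem slope_itoDrift_eq (κ : ℝ≥0) {x y : ℝ} (hy : y ≠ 0) (F : ℝ → ℝ) :
    (x * loewnerInvImDrift x y + y⁻¹ * loewnerReDrift x y) * deriv F (x * y⁻¹) +
      2⁻¹ * (-Real.sqrt κ * y⁻¹) ^ 2 * iteratedDeriv 2 F (x * y⁻¹) =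
    (y⁻¹) ^ 2 * slopeGen κ F (x * y⁻¹) := by
  obtain ⟨w, rfl⟩ : ∃ w, x = w * y := ⟨x * y⁻¹, by field_simp⟩
  have hw : w * y * y⁻¹ = w := mul_inv_cancel_right₀ hy w
  rw [hw, slopeGen_apply, loewnerInvImDrift_apply, loewnerReDrift_apply]
  have hκ : Real.sqrt κ ^ 2 = κ := Real.sq_sqrt κ.coe_nonneg
  have h1 : (w * y) ^ 2 + y ^ 2 = y ^ 2 * (1 + w ^ 2) := by ring
  have hpos : (0 : ℝ) < 1 + w ^ 2 := by positivity
  have h2 : (-Real.sqrt κ * y⁻¹) ^ 2 = κ * y⁻¹ ^ 2 := by rw [mul_pow, neg_sq, hκ]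
  rw [h1, h2]
  field_simp
  ring

end Generator

/-! ### The stopped slope and the drift of `F(w) E` -/

section Processes

variable (κ : ℝ≥0) (z : ℂ) (σ : (ℝ≥0 → ℝ) → WithTop ℝ≥0)

/-- **The stopped slope** `w_{t∧σ} = x_{t∧σ}/y_{t∧σ}` of the centred SLE_κ flow at `z`, as the
product of the stopped real part and the inverse stopped imaginary part (`SLEPointFlowStopped`);
equal to `cotArg (√κ B) z (t ∧ σ)` for `σ ≤ ρₙ` (`sleStopSlope_eq_cotArg`).
[cite: RohdeSchramm2005, Lemma 6.3 (proof)] -/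
def sleStopSlope (t : ℝ≥0) (ω : ℝ≥0 → ℝ) : ℝ :=
  stoppedProcess (slePointRe κ z) σ t ω * (stoppedProcess (slePointIm κ z) σ t ω)⁻¹

/-- **The drift of `F(w_{t∧σ}) Eₜ`**: `𝟙_{s ≤ σ} Eₛ yₛ⁻² (A F)(wₛ) + F(wₛ) βₛ Eₛ` (the second term is
the finite-variation contribution `F(w) dE = F(w) β E ds`). [folklore] -/
def slopeFunctionalDrift (F : ℝ → ℝ) (E β : ℝ≥0 → (ℝ≥0 → ℝ) → ℝ) : ℝ≥0 → (ℝ≥0 → ℝ) → ℝ :=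
  fun s ω ↦ trunc σ (fun s ω ↦ (stoppedProcess (slePointIm κ z) σ s ω)⁻¹ ^ 2 *
      slopeGen κ F (sleStopSlope κ z σ s ω)) s ω * E s ω +
    F (sleStopSlope κ z σ s ω) * (β s ω * E s ω)

variable {κ z σ} {n : ℕ}

/-- Unfolding lemma for `sleStopSlope`. [folklore] -/
theorem sleStopSlope_apply (t : ℝ≥0) (ω : ℝ≥0 → ℝ) :
    sleStopSlope κ z σ t ω =
      stoppedProcess (slePointRe κ z) σ t ω * (stoppedProcess (slePointIm κ z) σ t ω)⁻¹ := rfl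

/-- Unfolding lemma for `slopeFunctionalDrift`. [folklore] -/
theorem slopeFunctionalDrift_apply (F : ℝ → ℝ) (E β : ℝ≥0 → (ℝ≥0 → ℝ) → ℝ) (s : ℝ≥0)
    (ω : ℝ≥0 → ℝ) :
    slopeFunctionalDrift κ z σ F E β s ω =
      trunc σ (fun s ω ↦ (stoppedProcess (slePointIm κ z) σ s ω)⁻¹ ^ 2 *
          slopeGen κ F (sleStopSlope κ z σ s ω)) s ω * E s ω +
        F (sleStopSlope κ z σ s ω) * (β s ω * E s ω) := rfl

/-- The stopped slope is the slope at the stopped clock: `w_{t∧σ} = cot arg z_{t∧σ}` (`σ ≤ ρₙ`).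
[folklore] -/
theorem sleStopSlope_eq_cotArg (hz : 0 < z.im) (hσρ : ∀ ω, σ ω ≤ slePointLocTime κ z n ω)
    (t : ℝ≥0) (ω : ℝ≥0 → ℝ) :
    sleStopSlope κ z σ t ω = cotArg (sleDriving κ ω) z ((min (t : WithTop ℝ≥0) (σ ω)).untopA) := by
  rw [sleStopSlope_apply, ← div_eq_mul_inv, stopped_div_eq_cotArg hz hσρ]

/-- The stopped slope is the stopped process of the slope `t ↦ cotArg (√κ B) z t` (`σ ≤ ρₙ`).
[folklore] -/
theorem sleStopSlope_eq_stoppedProcess (hz : 0 < z.im)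
    (hσρ : ∀ ω, σ ω ≤ slePointLocTime κ z n ω) :
    sleStopSlope κ z σ = stoppedProcess (fun t ω ↦ cotArg (sleDriving κ ω) z t) σ := by
  funext t ω
  rw [sleStopSlope_eq_cotArg hz hσρ]
  rfl

/-- At time `0` the stopped slope is `re z / im z`. [folklore] -/
theorem sleStopSlope_zero (hz : 0 < z.im) (ω : ℝ≥0 → ℝ) :
    sleStopSlope κ z σ 0 ω = z.re / z.im := by
  rw [sleStopSlope_apply, stoppedProcess_slePointRe_zero hz, stoppedProcess_slePointIm_zero hz,
    div_eq_mul_inv]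

/-- The stopped slope is bounded by `S` when `|w| ≤ S` on `[0, σ]`. [folklore] -/
theorem abs_sleStopSlope_le (hz : 0 < z.im) (hσρ : ∀ ω, σ ω ≤ slePointLocTime κ z n ω)
    {S : ℝ} (hS : ∀ (ω : ℝ≥0 → ℝ) (t : ℝ≥0), (t : WithTop ℝ≥0) ≤ σ ω →
      |cotArg (sleDriving κ ω) z t| ≤ S) (t : ℝ≥0) (ω : ℝ≥0 → ℝ) :
    |sleStopSlope κ z σ t ω| ≤ S := by
  rw [sleStopSlope_eq_cotArg hz hσρ]
  exact hS ω _ (coe_untopA_min_le t (σ ω))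

/-- Every path of the stopped slope is continuous (`σ ≤ ρₙ`). [folklore] -/
theorem continuous_sleStopSlope (hz : 0 < z.im) (hσρ : ∀ ω, σ ω ≤ slePointLocTime κ z n ω)
    (ω : ℝ≥0 → ℝ) : Continuous fun t ↦ sleStopSlope κ z σ t ω :=
  (continuous_stoppedProcess_slePointRe hz hσρ ω).mul
    ((continuous_stoppedProcess_slePointIm hz σ ω).inv₀
      fun t ↦ (stoppedProcess_slePointIm_pos hz hσρ t ω).ne')

/-- The stopped slope is strongly adapted (`σ` a stopping time). [folklore] -/
theorem stronglyAdapted_sleStopSlope (hz : 0 < z.im) (hσ : IsStoppingTime brownianFiltration σ) :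
    StronglyAdapted brownianFiltration (sleStopSlope κ z σ) := fun t ↦
  (stronglyAdapted_stoppedProcess_slePointRe hz hσ t).mul
    (stronglyAdapted_stoppedProcess_slePointIm hz hσ t).measurable.inv.stronglyMeasurable

/-- The stopped slope is progressive (`σ` a stopping time, `σ ≤ ρₙ`). [folklore] -/
theorem isStronglyProgressive_sleStopSlope (hz : 0 < z.im)
    (hσ : IsStoppingTime brownianFiltration σ) (hσρ : ∀ ω, σ ω ≤ slePointLocTime κ z n ω) :
    IsStronglyProgressive brownianFiltration (sleStopSlope κ z σ) :=
  (stronglyAdapted_sleStopSlope hz hσ).isStronglyProgressive_of_continuous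
    (continuous_sleStopSlope hz hσρ)

end Processes

/-! ### The Itô decomposition of `F(w_{t∧σ}) Eₜ` -/

section Main

variable {κ : ℝ≥0} {z : ℂ} {n : ℕ} {σ : (ℝ≥0 → ℝ) → WithTop ℝ≥0}

/-- **Itô decomposition of `F(w_{t∧σ}) Eₜ`.** Let `κ > 0`, `z ∈ ℍ`, `σ` a stopping time of the raw
Brownian filtration with `σ ≤ ρₙ = slePointLocTime κ z n` and `|wₜ| ≤ S` on `[0, σ]`; let
`F ∈ C²(ℝ)`; let `E` be strongly adapted with continuous paths, `|E| ≤ C_E`, solving pathwise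
`Eₜ = 1 + ∫₀ᵗ βₛ Eₛ ds` with `β` progressive, `|β| ≤ C_β`. Then there is a martingale `K` (a
square-integrable Itô integral: a.s. continuous paths, `K₀ = 0`) with, almost surely for all `t`,
`F(w_{t∧σ}) Eₜ = F(re z/im z) + ∫₀ᵗ (𝟙_{s≤σ} Eₛ yₛ⁻² (A F)(wₛ) + F(wₛ) βₛ Eₛ) ds + Kₜ`
(`slopeFunctionalDrift`). Proof: `x^σ` is an Itô process (`isItoProcess_stoppedProcess_slePointRe`),
`w = x · (1/y)` by the product rule, `F(w)` by Itô's formula (`ito_formula_itoProcess_ae_holds`),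
`F(w) · E` by the product rule (`ae_mul_eq_of_isItoProcess`); the drift of `F(w)` is identified by
`slope_itoDrift_eq`. Revuz–Yor (1999), Ch. IV, Prop. (3.1), Thm (3.3); Rohde–Schramm (2005), proof
of Lemma 6.3. [cite: RevuzYor1999, Ch. IV Thm (3.3)] -/
theorem exists_martingale_slopeFunctional (hz : 0 < z.im)
    (hσ : IsStoppingTime brownianFiltration σ) (hσρ : ∀ ω, σ ω ≤ slePointLocTime κ z n ω)
    {S : ℝ} (hS : ∀ (ω : ℝ≥0 → ℝ) (t : ℝ≥0), (t : WithTop ℝ≥0) ≤ σ ω →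
      |cotArg (sleDriving κ ω) z t| ≤ S)
    {F : ℝ → ℝ} (hF : ContDiff ℝ 2 F) {E β : ℝ≥0 → (ℝ≥0 → ℝ) → ℝ}
    (hEa : StronglyAdapted brownianFiltration E) (hEc : ∀ ω, Continuous (E · ω))
    (hβ : IsStronglyProgressive brownianFiltration β) {Cβ : ℝ} (hCβ : ∀ t ω, |β t ω| ≤ Cβ)
    {CE : ℝ} (hCE : ∀ t ω, |E t ω| ≤ CE)
    (hEeq : ∀ (ω : ℝ≥0 → ℝ) (t : ℝ≥0),
      E t ω = 1 + ∫ s in (0 : ℝ)..t, β s.toNNReal ω * E s.toNNReal ω) :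
    ∃ K : ℝ≥0 → (ℝ≥0 → ℝ) → ℝ, Martingale K brownianFiltration preWienerMeasure ∧
      (∀ᵐ ω ∂preWienerMeasure, Continuous (K · ω)) ∧ (∀ ω, K 0 ω = 0) ∧
      ∀ᵐ ω ∂preWienerMeasure, ∀ t : ℝ≥0,
        F (sleStopSlope κ z σ t ω) * E t ω = F (z.re / z.im) +
          (∫ s in (0 : ℝ)..t, slopeFunctionalDrift κ z σ F E β s.toNNReal ω) + K t ω := by
  haveI := isProbabilityMeasure_preWienerMeasure'
  have hσ' : ∀ t : ℝ≥0, MeasurableSet[brownianFiltration t] {ω | σ ω < t} :=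
    fun t ↦ hσ.measurableSet_lt t
  have hl0 : 0 < z.im / (n + 2) := (level_pos_lt hz n).1
  -- the processes
  set X : ℝ≥0 → (ℝ≥0 → ℝ) → ℝ := stoppedProcess (slePointRe κ z) σ with hXdef
  set Y : ℝ≥0 → (ℝ≥0 → ℝ) → ℝ := stoppedProcess (slePointIm κ z) σ with hYdef
  set A : ℝ≥0 → (ℝ≥0 → ℝ) → ℝ := fun t ω ↦ (Y t ω)⁻¹ with hAdef
  set w : ℝ≥0 → (ℝ≥0 → ℝ) → ℝ := fun t ω ↦ X t ω * A t ω with hwdef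
  have hwslope : ∀ t ω, sleStopSlope κ z σ t ω = w t ω := fun t ω ↦ rfl
  set σB : ℝ≥0 → (ℝ≥0 → ℝ) → ℝ := trunc σ (fun _ _ ↦ -Real.sqrt κ) with hσBdef
  set bX : ℝ≥0 → (ℝ≥0 → ℝ) → ℝ := trunc σ (fun s ω ↦ loewnerReDrift (X s ω) (Y s ω)) with hbXdef
  set aA : ℝ≥0 → (ℝ≥0 → ℝ) → ℝ := trunc σ (fun s ω ↦ loewnerInvImDrift (X s ω) (Y s ω)) with haAdef
  set aE : ℝ≥0 → (ℝ≥0 → ℝ) → ℝ := fun s ω ↦ β s ω * E s ω with haEdef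
  set bw : ℝ≥0 → (ℝ≥0 → ℝ) → ℝ := fun t ω ↦ X t ω * aA t ω + A t ω * bX t ω with hbwdef
  set σw : ℝ≥0 → (ℝ≥0 → ℝ) → ℝ := fun t ω ↦ σB t ω * A t ω with hσwdef
  set D1 : ℝ≥0 → (ℝ≥0 → ℝ) → ℝ := fun t ω ↦
    bw t ω * deriv F (w t ω) + 2⁻¹ * σw t ω ^ 2 * iteratedDeriv 2 F (w t ω) with hD1def
  set σG : ℝ≥0 → (ℝ≥0 → ℝ) → ℝ := fun t ω ↦ σw t ω * deriv F (w t ω) with hσGdef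
  -- pathwise values and bounds
  have hYpos : ∀ t ω, 0 < Y t ω := fun t ω ↦ stoppedProcess_slePointIm_pos hz hσρ t ω
  have hYlev : ∀ t ω, z.im / (n + 2) ≤ Y t ω := fun t ω ↦ level_le_stoppedProcess_slePointIm hz hσρ t ω
  have hYle : ∀ t ω, Y t ω ≤ z.im := fun t ω ↦ stoppedProcess_slePointIm_le hz hσρ t ω
  have hwS : ∀ t ω, |w t ω| ≤ S := fun t ω ↦ by
    rw [← hwslope]; exact abs_sleStopSlope_le hz hσρ hS t ω
  have hS0 : 0 ≤ S := (abs_nonneg _).trans (hwS 0 fun _ ↦ 0)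
  have hwmem : ∀ t ω, w t ω ∈ Icc (-S) S := fun t ω ↦ abs_le.1 (hwS t ω)
  have hXbd : ∀ t ω, |X t ω| ≤ S * z.im := fun t ω ↦ by
    have hx : X t ω = w t ω * Y t ω := by
      simp only [hwdef, hAdef]; rw [inv_mul_cancel_right₀ (hYpos t ω).ne']
    rw [hx, abs_mul, abs_of_pos (hYpos t ω)]
    exact mul_le_mul (hwS t ω) (hYle t ω) (hYpos t ω).le hS0
  have hAbd : ∀ t ω, |A t ω| ≤ (n + 2) / z.im := fun t ω ↦ by
    simp only [hAdef]
    rw [abs_of_pos (inv_pos.2 (hYpos t ω)), inv_eq_one_div, div_le_div_iff₀ (hYpos t ω) hz, one_mul]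
    have := hYlev t ω
    rw [div_le_iff₀ (by positivity : (0 : ℝ) < n + 2)] at this
    linarith
  have hσBbd : ∀ t ω, |σB t ω| ≤ Real.sqrt κ := fun t ω ↦ by
    simp only [hσBdef, trunc_apply]
    split_ifs
    · rw [abs_neg, abs_of_nonneg (Real.sqrt_nonneg _)]
    · rw [abs_zero]; exact Real.sqrt_nonneg _
  have hCE0 : 0 ≤ CE := (abs_nonneg _).trans (hCE 0 fun _ ↦ 0)
  have hCβ0 : 0 ≤ Cβ := (abs_nonneg _).trans (hCβ 0 fun _ ↦ 0)
  -- bounds for `F, F'` on `[-S, S]`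
  have hc0 : Continuous F := hF.continuous
  have hc1 : Continuous (deriv F) := hF.continuous_deriv (by norm_num)
  have hc2 : Continuous (iteratedDeriv 2 F) := hF.continuous_iteratedDeriv 2 le_rfl
  obtain ⟨C0, hC0⟩ : ∃ C, ∀ v ∈ Icc (-S) S, |F v| ≤ C := by
    obtain ⟨C, hC⟩ := isCompact_Icc.exists_bound_of_continuousOn hc0.continuousOn
    exact ⟨C, fun v hv ↦ by simpa [Real.norm_eq_abs] using hC v hv⟩
  obtain ⟨C1, hC1⟩ : ∃ C, ∀ v ∈ Icc (-S) S, |deriv F v| ≤ C := by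
    obtain ⟨C, hC⟩ := isCompact_Icc.exists_bound_of_continuousOn hc1.continuousOn
    exact ⟨C, fun v hv ↦ by simpa [Real.norm_eq_abs] using hC v hv⟩
  have hC00 : 0 ≤ C0 := (abs_nonneg _).trans (hC0 _ (hwmem 0 fun _ ↦ 0))
  have hC10 : 0 ≤ C1 := (abs_nonneg _).trans (hC1 _ (hwmem 0 fun _ ↦ 0))
  -- path regularity
  have hXc : ∀ ω, Continuous (X · ω) := fun ω ↦ continuous_stoppedProcess_slePointRe hz hσρ ω
  have hYc : ∀ ω, Continuous (Y · ω) := fun ω ↦ continuous_stoppedProcess_slePointIm hz σ ω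
  have hAc : ∀ ω, Continuous (A · ω) := fun ω ↦ (hYc ω).inv₀ fun t ↦ (hYpos t ω).ne'
  have hwc : ∀ ω, Continuous (w · ω) := fun ω ↦ (hXc ω).mul (hAc ω)
  have hGc : ∀ ω, Continuous (fun t ↦ F (w t ω)) := fun ω ↦ hc0.comp (hwc ω)
  -- adaptedness and progressive measurability
  have hXa : StronglyAdapted brownianFiltration X := stronglyAdapted_stoppedProcess_slePointRe hz hσ
  have hYa : StronglyAdapted brownianFiltration Y := stronglyAdapted_stoppedProcess_slePointIm hz hσ
  have hAa : StronglyAdapted brownianFiltration A := fun t ↦ (hYa t).measurable.inv.stronglyMeasurable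
  have hwa : StronglyAdapted brownianFiltration w := fun t ↦ (hXa t).mul (hAa t)
  have hGa : StronglyAdapted brownianFiltration fun t ω ↦ F (w t ω) := fun t ↦
    hc0.comp_stronglyMeasurable (hwa t)
  have hXp : IsStronglyProgressive brownianFiltration X := hXa.isStronglyProgressive_of_continuous hXc
  have hYp : IsStronglyProgressive brownianFiltration Y := hYa.isStronglyProgressive_of_continuous hYc
  have hAp : IsStronglyProgressive brownianFiltration A := hAa.isStronglyProgressive_of_continuous hAc
  have hwp : IsStronglyProgressive brownianFiltration w := hXp.mul hAp
  have hEp : IsStronglyProgressive brownianFiltration E := hEa.isStronglyProgressive_of_continuous hEc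
  have hGp : IsStronglyProgressive brownianFiltration fun t ω ↦ F (w t ω) :=
    IsStronglyProgressive.continuous_comp hwp hc0
  have hG1p : IsStronglyProgressive brownianFiltration fun t ω ↦ deriv F (w t ω) :=
    IsStronglyProgressive.continuous_comp hwp hc1
  have hσBp : IsStronglyProgressive brownianFiltration σB :=
    isStronglyProgressive_trunc (isStronglyProgressive_const _ _) hσ'
  have hσwp : IsStronglyProgressive brownianFiltration σw := hσBp.mul hAp
  have hσGp : IsStronglyProgressive brownianFiltration σG := hσwp.mul hG1p
  have haEp : IsStronglyProgressive brownianFiltration aE := hβ.mul hEp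
  have hσwbd : ∀ t ω, |σw t ω| ≤ Real.sqrt κ * ((n + 2) / z.im) := fun t ω ↦ by
    simp only [hσwdef]; rw [abs_mul]
    exact mul_le_mul (hσBbd t ω) (hAbd t ω) (abs_nonneg _) (Real.sqrt_nonneg _)
  have hσGbd : ∀ t ω, |σG t ω| ≤ Real.sqrt κ * ((n + 2) / z.im) * C1 := fun t ω ↦ by
    simp only [hσGdef]; rw [abs_mul]
    exact mul_le_mul (hσwbd t ω) (hC1 _ (hwmem t ω)) (abs_nonneg _) (by positivity)
  have haEbd : ∀ t ω, |aE t ω| ≤ Cβ * CE := fun t ω ↦ by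
    simp only [haEdef]; rw [abs_mul]
    exact mul_le_mul (hCβ t ω) (hCE t ω) (abs_nonneg _) hCβ0
  ---------------------------------------------------------------------------
  -- Step 1: `x^σ` is an Itô process
  have hX : IsItoProcess X bX σB brownian brownianFiltration preWienerMeasure :=
    isItoProcess_stoppedProcess_slePointRe hz hσ hσρ
  ---------------------------------------------------------------------------
  -- Step 2: `w = x · (1/y)` is an Itô process (product rule)
  obtain ⟨KX, hKX, hKXM⟩ := exists_isItoIntegral_of_abs_le (hσBp.mul hXp)
    (C := Real.sqrt κ * (S * z.im)) fun t ω ↦ by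
      rw [abs_mul]; exact mul_le_mul (hσBbd t ω) (hXbd t ω) (abs_nonneg _) (Real.sqrt_nonneg _)
  obtain ⟨K, hK, hKM⟩ := exists_isItoIntegral_of_abs_le (hσBp.mul hAp)
    (C := Real.sqrt κ * ((n + 2) / z.im)) fun t ω ↦ by
      rw [abs_mul]; exact mul_le_mul (hσBbd t ω) (hAbd t ω) (abs_nonneg _) (Real.sqrt_nonneg _)
  have hA0 : ∀ ω, A 0 ω = (z.im)⁻¹ := fun ω ↦ by
    simp only [hAdef, hYdef]; rw [stoppedProcess_slePointIm_zero hz]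
  have hAeq : ∀ᵐ ω ∂preWienerMeasure, ∀ t : ℝ≥0, A t ω = A 0 ω + ∫ s in (0 : ℝ)..t, aA s.toNNReal ω :=
    ae_of_all _ fun ω t ↦ by
      rw [hA0]
      exact inv_stoppedProcess_slePointIm_eq_integral hz hσρ t ω
  have haA : ∀ᵐ ω ∂preWienerMeasure, ∀ t : ℝ≥0,
      IntegrableOn (fun s : ℝ ↦ aA s.toNNReal ω) (Icc 0 t) :=
    ae_of_all _ fun ω t ↦ integrableOn_trunc_loewnerInvImDrift hz hσρ ω _ isCompact_Icc
  have hw : IsItoProcess w bw σw brownian brownianFiltration preWienerMeasure :=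
    IsItoProcess.mul_timeIntegral hXa hXc hσBp hX hAa hAc hAeq haA hKX hKXM hK hKM
  ---------------------------------------------------------------------------
  -- Step 3: `F(w)` is an Itô process (Itô's formula)
  obtain ⟨Kw, hKw, hKwM⟩ := exists_isItoIntegral_of_abs_le hσGp hσGbd
  have hf' : ContDiff ℝ 2 (Function.uncurry fun (_ : ℝ) (v : ℝ) ↦ F v) := hF.comp contDiff_snd
  have hito := ito_formula_itoProcess_ae_holds (fun (_ : ℝ) (v : ℝ) ↦ F v) hf'
    (fun t ↦ (hwa t).measurable) hσwp hw (K := Kw) (by exact hKw)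
  have hGint := hw.ae_integrableOn_itoDrift hf' hσwp
  have hG : IsItoProcess (fun t ω ↦ F (w t ω)) D1 σG brownian brownianFiltration preWienerMeasure := by
    refine ⟨?_, Kw, hKw, ?_⟩
    · filter_upwards [hGint] with ω hω t
      have h1 := hω t
      simp only [deriv_const, zero_add] at h1
      exact h1
    · filter_upwards [hito] with ω hω t
      have h1 := hω t
      simp only [deriv_const, zero_add] at h1
      exact h1
  ---------------------------------------------------------------------------
  -- Step 4: the product `F(w) E` (product rule again)
  obtain ⟨KX', hKX', hKX'M⟩ := exists_isItoIntegral_of_abs_le (hσGp.mul hGp)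
    (C := Real.sqrt κ * ((n + 2) / z.im) * C1 * C0) fun t ω ↦ by
      rw [abs_mul]; exact mul_le_mul (hσGbd t ω) (hC0 _ (hwmem t ω)) (abs_nonneg _) (by positivity)
  obtain ⟨K', hK', hK'M⟩ := exists_isItoIntegral_of_abs_le (hσGp.mul hEp)
    (C := Real.sqrt κ * ((n + 2) / z.im) * C1 * CE) fun t ω ↦ by
      rw [abs_mul]; exact mul_le_mul (hσGbd t ω) (hCE t ω) (abs_nonneg _) (by positivity)
  have hE0 : ∀ ω, E 0 ω = 1 := fun ω ↦ by
    have h := hEeq ω 0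
    simp only [NNReal.coe_zero, intervalIntegral.integral_same, add_zero] at h
    exact h
  have hEeq' : ∀ᵐ ω ∂preWienerMeasure, ∀ t : ℝ≥0, E t ω = E 0 ω + ∫ s in (0 : ℝ)..t, aE s.toNNReal ω :=
    ae_of_all _ fun ω t ↦ by rw [hE0]; exact hEeq ω t
  have haE : ∀ᵐ ω ∂preWienerMeasure, ∀ t : ℝ≥0,
      IntegrableOn (fun s : ℝ ↦ aE s.toNNReal ω) (Icc 0 t) :=
    ae_of_all _ fun ω t ↦ integrableOn_Icc_of_abs_le haEp haEbd ω t
  have hprod := ae_mul_eq_of_isItoProcess hGa hGc hσGp hG hEa hEc hEeq' haE hKX' hKX'M hK' hK'M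
  ---------------------------------------------------------------------------
  -- Step 5: the drift of `F(w) E` is `slopeFunctionalDrift`
  have hdrift : ∀ s ω, F (w s ω) * aE s ω + E s ω * D1 s ω =
      slopeFunctionalDrift κ z σ F E β s ω := by
    intro s ω
    have hY' : stoppedProcess (slePointIm κ z) σ s ω = Y s ω := rfl
    rw [slopeFunctionalDrift_apply, hwslope]
    by_cases hs : (s : WithTop ℝ≥0) ≤ σ ω
    · simp only [haEdef, hD1def, hbwdef, hσwdef, hσBdef, hbXdef, haAdef, trunc_of_le hs, hwslope, hY',
        hwdef, hAdef]
      rw [slope_itoDrift_eq κ (hYpos s ω).ne' F]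
      ring
    · simp only [haEdef, hD1def, hbwdef, hσwdef, hσBdef, hbXdef, haAdef, trunc_of_not_le hs]
      ring
  ---------------------------------------------------------------------------
  -- Step 6: assemble
  have hw0 : ∀ ω, w 0 ω = z.re / z.im := fun ω ↦ by
    rw [← hwslope]; exact sleStopSlope_zero hz ω
  refine ⟨K', hK'M, hK'.continuous, hK'.apply_zero, ?_⟩
  filter_upwards [hprod] with ω hω t
  have h1 := hω t
  rw [hw0, hE0, mul_one] at h1
  rw [hwslope, h1]
  congr 2
  refine intervalIntegral.integral_congr fun s _ ↦ ?_
  exact hdrift _ ω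

end Main

/-! ### Optional stopping tools -/

section OptionalStopping

variable {Ω : Type*} {m : MeasurableSpace Ω} {𝓕 : Filtration ℝ≥0 m} {P : Measure Ω}

open Classical in
/-- **The piecewise time `T_G`**: `T₁` on `G`, `T₂` off `G`. [folklore] -/
def piecewiseTime (G : Set Ω) (T₁ T₂ : Ω → WithTop ℝ≥0) : Ω → WithTop ℝ≥0 :=
  fun ω ↦ if ω ∈ G then T₁ ω else T₂ ω

omit m in
/-- On `G`, `T_G = T₁`. [folklore] -/
theorem piecewiseTime_of_mem {G : Set Ω} {T₁ T₂ : Ω → WithTop ℝ≥0} {ω : Ω} (h : ω ∈ G) :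
    piecewiseTime G T₁ T₂ ω = T₁ ω := by
  simp only [piecewiseTime, if_pos h]

omit m in
/-- Off `G`, `T_G = T₂`. [folklore] -/
theorem piecewiseTime_of_notMem {G : Set Ω} {T₁ T₂ : Ω → WithTop ℝ≥0} {ω : Ω} (h : ω ∉ G) :
    piecewiseTime G T₁ T₂ ω = T₂ ω := by
  simp only [piecewiseTime, if_neg h]

omit m in
/-- `T₁ ≤ T_G` when `T₁ ≤ T₂`. [folklore] -/
theorem le_piecewiseTime {G : Set Ω} {T₁ T₂ : Ω → WithTop ℝ≥0} (hle : ∀ ω, T₁ ω ≤ T₂ ω) (ω : Ω) :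
    T₁ ω ≤ piecewiseTime G T₁ T₂ ω := by
  by_cases h : ω ∈ G
  · rw [piecewiseTime_of_mem h]
  · rw [piecewiseTime_of_notMem h]; exact hle ω

omit m in
/-- `T_G ≤ T₂` when `T₁ ≤ T₂`. [folklore] -/
theorem piecewiseTime_le {G : Set Ω} {T₁ T₂ : Ω → WithTop ℝ≥0} (hle : ∀ ω, T₁ ω ≤ T₂ ω) (ω : Ω) :
    piecewiseTime G T₁ T₂ ω ≤ T₂ ω := by
  by_cases h : ω ∈ G
  · rw [piecewiseTime_of_mem h]; exact hle ω
  · rw [piecewiseTime_of_notMem h]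

/-- **`T_G` is a stopping time** for stopping times `T₁ ≤ T₂` and `G ∈ 𝓕_{T₁}`:
`{T_G ≤ t} = (G ∩ {T₁ ≤ t}) ∪ (Gᶜ ∩ {T₁ ≤ t} ∩ {T₂ ≤ t})`. Revuz–Yor (1999), Ch. I, §4
(Exercise (4.19) type). [folklore] -/
theorem isStoppingTime_piecewiseTime {G : Set Ω} {T₁ T₂ : Ω → WithTop ℝ≥0}
    (hT₁ : IsStoppingTime 𝓕 T₁) (hT₂ : IsStoppingTime 𝓕 T₂) (hle : ∀ ω, T₁ ω ≤ T₂ ω)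
    (hG : MeasurableSet[hT₁.measurableSpace] G) : IsStoppingTime 𝓕 (piecewiseTime G T₁ T₂) := by
  intro t
  have hG1 : MeasurableSet[𝓕 t] (G ∩ {ω | T₁ ω ≤ t}) := hG.2 t
  have hGc : MeasurableSet[hT₁.measurableSpace] Gᶜ := hG.compl
  have hG2 : MeasurableSet[𝓕 t] (Gᶜ ∩ {ω | T₁ ω ≤ t}) := hGc.2 t
  have heq : {ω | piecewiseTime G T₁ T₂ ω ≤ t} =
      (G ∩ {ω | T₁ ω ≤ t}) ∪ (Gᶜ ∩ {ω | T₁ ω ≤ t} ∩ {ω | T₂ ω ≤ t}) := by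
    ext ω
    simp only [mem_setOf_eq, mem_union, mem_inter_iff, mem_compl_iff]
    by_cases h : ω ∈ G
    · rw [piecewiseTime_of_mem h]
      exact ⟨fun h' ↦ Or.inl ⟨h, h'⟩, fun h' ↦ h'.elim (fun h'' ↦ h''.2) fun h'' ↦ absurd h h''.1.1⟩
    · rw [piecewiseTime_of_notMem h]
      refine ⟨fun h' ↦ Or.inr ⟨⟨h, (hle ω).trans h'⟩, h'⟩, fun h' ↦ h'.elim (fun h'' ↦ absurd h''.1 h) ?_⟩
      exact fun h'' ↦ h''.2
  rw [heq]
  exact hG1.union (hG2.inter (hT₂ t))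

variable [IsFiniteMeasure P]

/-- **`E[K_T] = 0`** for a martingale `K` with a.s. continuous paths and `K₀ = 0`, and a
stopping time `T` bounded by `N`: the stopped process `K^T` is an a.e. martingale
(`Martingale.isAEMartingale_stoppedProcess`), so `E[K_T] = E[K^T_N] = E[K^T_0] = E[K_0] = 0`.
Le Gall (2016), Cor. 3.24; Revuz–Yor (1999), Ch. II, Thm (3.2). [cite: Legall2016, Cor. 3.24] -/
theorem integral_stoppedValue_eq_zero_of_martingale {K : ℝ≥0 → Ω → ℝ} (hKM : Martingale K 𝓕 P)
    (hKc : ∀ᵐ ω ∂P, Continuous (K · ω)) (hK0 : ∀ ω, K 0 ω = 0) {T : Ω → WithTop ℝ≥0}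
    (hT : IsStoppingTime 𝓕 T) {N : ℝ≥0} (hTN : ∀ ω, T ω ≤ N) :
    ∫ ω, K (T ω).untopA ω ∂P = 0 := by
  have hAE := hKM.isAEMartingale_stoppedProcess hKc hT.isOptionalTime
  have h1 := hAE.setIntegral_eq (show (0 : ℝ≥0) ≤ N from bot_le) (A := univ) MeasurableSet.univ
  simp only [Measure.restrict_univ] at h1
  have h2 : ∀ ω, stoppedProcess K T N ω = K (T ω).untopA ω := fun ω ↦ by
    simp only [stoppedProcess, min_eq_right (hTN ω)]
  have h3 : ∀ ω, stoppedProcess K T 0 ω = 0 := fun ω ↦ by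
    simp only [stoppedProcess]
    have : min ((0 : ℝ≥0) : WithTop ℝ≥0) (T ω) = (0 : ℝ≥0) := min_eq_left (by simp)
    rw [this]
    exact hK0 ω
  simp_rw [h2, h3, integral_zero] at h1
  exact h1

/-- The stopped value of such a martingale at a bounded stopping time is integrable. [folklore] -/
theorem integrable_stoppedValue_of_martingale {K : ℝ≥0 → Ω → ℝ} (hKM : Martingale K 𝓕 P)
    (hKc : ∀ᵐ ω ∂P, Continuous (K · ω)) {T : Ω → WithTop ℝ≥0}
    (hT : IsStoppingTime 𝓕 T) {N : ℝ≥0} (hTN : ∀ ω, T ω ≤ N) :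
    Integrable (fun ω ↦ K (T ω).untopA ω) P := by
  have hAE := hKM.isAEMartingale_stoppedProcess hKc hT.isOptionalTime
  have h2 : ∀ ω, stoppedProcess K T N ω = K (T ω).untopA ω := fun ω ↦ by
    simp only [stoppedProcess, min_eq_right (hTN ω)]
  have h2' : stoppedProcess K T N = fun ω ↦ K (T ω).untopA ω := funext h2
  have := hAE.integrable N
  rw [h2'] at this
  exact this

/-- **`∫_G (K_{T₂} - K_{T₁}) dP = 0`** for a martingale `K` with a.s. continuous paths and
`K₀ = 0`, stopping times `T₁ ≤ T₂ ≤ N` and `G ∈ 𝓕_{T₁}`: apply `E[K_T] = 0` to `T₂` and to the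
stopping time `T_G` (`isStoppingTime_piecewiseTime`) and subtract. This is the optional
stopping theorem `E[K_{T₂} | 𝓕_{T₁}] = K_{T₁}` tested on `G`. Revuz–Yor (1999), Ch. II, Thm (3.2).
[cite: RevuzYor1999, Ch. II Thm (3.2)] -/
theorem setIntegral_stoppedValue_sub_eq_zero {K : ℝ≥0 → Ω → ℝ} (hKM : Martingale K 𝓕 P)
    (hKc : ∀ᵐ ω ∂P, Continuous (K · ω)) (hK0 : ∀ ω, K 0 ω = 0) {T₁ T₂ : Ω → WithTop ℝ≥0}
    (hT₁ : IsStoppingTime 𝓕 T₁) (hT₂ : IsStoppingTime 𝓕 T₂) (hle : ∀ ω, T₁ ω ≤ T₂ ω)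
    {N : ℝ≥0} (hTN : ∀ ω, T₂ ω ≤ N) {G : Set Ω} (hG : MeasurableSet[hT₁.measurableSpace] G) :
    ∫ ω in G, (K (T₂ ω).untopA ω - K (T₁ ω).untopA ω) ∂P = 0 := by
  classical
  have hTG := isStoppingTime_piecewiseTime hT₁ hT₂ hle hG
  have hTGN : ∀ ω, piecewiseTime G T₁ T₂ ω ≤ N := fun ω ↦ (piecewiseTime_le hle ω).trans (hTN ω)
  have hT₁N : ∀ ω, T₁ ω ≤ N := fun ω ↦ (hle ω).trans (hTN ω)
  have h2 := integral_stoppedValue_eq_zero_of_martingale hKM hKc hK0 hT₂ hTN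
  have hG' := integral_stoppedValue_eq_zero_of_martingale hKM hKc hK0 hTG hTGN
  have hI₁ := integrable_stoppedValue_of_martingale hKM hKc hT₁ hT₁N
  have hI₂ := integrable_stoppedValue_of_martingale hKM hKc hT₂ hTN
  have hGm : MeasurableSet G := hG.1
  -- `K_{T_G} = 𝟙_G K_{T₁} + 𝟙_{Gᶜ} K_{T₂}`
  have hsplit : (fun ω ↦ K (piecewiseTime G T₁ T₂ ω).untopA ω) =
      fun ω ↦ G.indicator (fun ω ↦ K (T₁ ω).untopA ω - K (T₂ ω).untopA ω) ω + K (T₂ ω).untopA ω := by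
    funext ω
    by_cases h : ω ∈ G
    · rw [piecewiseTime_of_mem h, indicator_of_mem h]; ring
    · rw [piecewiseTime_of_notMem h, indicator_of_notMem h]; ring
  have hI3 : Integrable (fun ω ↦ G.indicator (fun ω ↦ K (T₁ ω).untopA ω - K (T₂ ω).untopA ω) ω) P :=
    (hI₁.sub hI₂).indicator hGm
  rw [hsplit, integral_add hI3 hI₂, h2, add_zero, integral_indicator hGm] at hG'
  have : ∫ ω in G, (K (T₂ ω).untopA ω - K (T₁ ω).untopA ω) ∂P =
      -∫ ω in G, (K (T₁ ω).untopA ω - K (T₂ ω).untopA ω) ∂P := by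
    rw [← integral_neg]
    refine integral_congr_ae (ae_of_all _ fun ω ↦ ?_)
    ring
  rw [this, hG', neg_zero]

end OptionalStopping

end Literature.Probability.RandomPlanarGeometry
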